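import Literature.Topology.FourManifolds.TautFoliationsEdgeChart
import Literature.Topology.FourManifolds.TautFoliationsContourSectors
import HarnessLib

/-!
# The roof–floor edge chart in all four positions

Topic: sequel to `TautFoliationsEdgeChart.lean`, which treats a roof square `Q = closedBall a ℓ`
with its floor neighbour on the RIGHT. A floor neighbour above, to the left or below is brought
to the right by a **motion of the plane** (an affine isometry of the max norm: the rotations by
right angles about `a`), which commutes with the cone coordinates about every centre:

* `ConeSquare.IsPlaneMotion` (**definition**) with `IsPlaneMotion.radial_eq`, `proj_eq`, `coneHt_eq`
  (**proved**): `coneHt (T b) ℓ m (ψ ∘ T⁻¹) (T x) = coneHt b ℓ m ψ x` for every centre `b`;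
  `isPlaneMotion_rot` (the right-angle rotation `ConeSquare.rot` of
  `TautFoliationsContourSectors` is a motion), `IsPlaneMotion.trans`, `isPlaneMotion_refl`;
* `ConeSquare.EdgeDataAt` (**definition**): roof/floor data of two adjacent squares in general
  position together with a motion `T` with `T b = T a + (2ℓ, 0)`; `EdgeDataAt.edgeData`
  (the transported data are standard edge data), `EdgeDataAt.chart` (**definition**: the chart
  `edgeChart ∘ T`), `EdgeDataAt.chart_source`, `EdgeDataAt.chart_snd` (its height coordinate is
  `coneHt a ℓ m ψ` on the `Q`-side and `σ (coneHt b ℓ m' ψ')` on the `Q'`-side),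
  `EdgeDataAt.symm_edgePt_mem_source`;
* `isPlaneMotion_rot_iterate`, `exists_motion_of_adjacent` (**proved**): for the four
  neighbours `b = a ± (2ℓ, 0)`, `a ± (0, 2ℓ)` such a motion exists (a power of `rot a`).

All statements are [folklore].
-/

noncomputable section

open Set Filter Metric Topology

namespace Literature.Topology.FourManifolds

namespace ConeSquare

variable {a b c : ℝ × ℝ} {ℓ m m' : ℝ} {ψ ψ' : ℝ × ℝ → ℝ} {σ : ℝ ≃o ℝ} {x q : ℝ × ℝ} {h : ℝ}

/-! ## Motions of the plane -/

/-- A **motion**: a homeomorphism of the plane preserving the max-norm distance and affine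
along segments. [folklore] -/
structure IsPlaneMotion (T : (ℝ × ℝ) ≃ₜ (ℝ × ℝ)) : Prop where
  dist_eq : ∀ x y, dist (T x) (T y) = dist x y
  affine : ∀ (b q : ℝ × ℝ) (t : ℝ), T (b + t • (q - b)) = T b + t • (T q - T b)

namespace IsPlaneMotion

variable {T : (ℝ × ℝ) ≃ₜ (ℝ × ℝ)} (hT : IsPlaneMotion T)
include hT

/-- A motion preserves the radial coordinate about corresponding centres. [folklore] -/
theorem radial_eq (b : ℝ × ℝ) (ℓ : ℝ) (x : ℝ × ℝ) : radial (T b) ℓ (T x) = radial b ℓ x := by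
  rw [radial_def, radial_def, hT.dist_eq]

/-- A motion commutes with the radial projections (off the centre). [folklore] -/
theorem proj_eq (b : ℝ × ℝ) (ℓ : ℝ) (hx : x ≠ b) : proj (T b) ℓ (T x) = T (proj b ℓ x) := by
  have hx' : T x ≠ T b := fun h' ↦ hx (T.injective h')
  rw [proj_of_ne hx', proj_of_ne hx, hT.dist_eq, hT.affine]

/-- A motion maps spheres to spheres. [folklore] -/
theorem mem_sphere_iff (b : ℝ × ℝ) (ℓ : ℝ) : T x ∈ sphere (T b) ℓ ↔ x ∈ sphere b ℓ := by
  rw [mem_sphere, mem_sphere, hT.dist_eq]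

/-- The inverse of a motion maps the sphere about `T b` to the sphere about `b`. [folklore] -/
theorem symm_mem_sphere (b : ℝ × ℝ) (ℓ : ℝ) (hq : q ∈ sphere (T b) ℓ) : T.symm q ∈ sphere b ℓ := by
  rw [← hT.mem_sphere_iff b ℓ, T.apply_symm_apply]; exact hq

/-- **The cone height is invariant under motions** (transporting centre, boundary heights and
point). [folklore] -/
theorem coneHt_eq (b : ℝ × ℝ) (ℓ m : ℝ) (ψ : ℝ × ℝ → ℝ) (x : ℝ × ℝ) :
    coneHt (T b) ℓ m (fun y ↦ ψ (T.symm y)) (T x) = coneHt b ℓ m ψ x := by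
  by_cases hx : x = b
  · subst hx; rw [coneHt_center, coneHt_center]
  · rw [coneHt_apply, coneHt_apply, hT.radial_eq, hT.proj_eq b ℓ hx, T.symm_apply_apply]

/-- Transported boundary heights below a roof apex stay below. [folklore] -/
theorem roof (b : ℝ × ℝ) (hm : ∀ q ∈ sphere b ℓ, ψ q < m) : ∀ q ∈ sphere (T b) ℓ, (fun y ↦ ψ (T.symm y)) q < m :=
  fun _ hq ↦ hm _ (hT.symm_mem_sphere b ℓ hq)

/-- Transported boundary heights above a floor apex stay above. [folklore] -/
theorem floor (b : ℝ × ℝ) (hm : ∀ q ∈ sphere b ℓ, m' < ψ' q) : ∀ q ∈ sphere (T b) ℓ, m' < (fun y ↦ ψ' (T.symm y)) q :=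
  fun _ hq ↦ hm _ (hT.symm_mem_sphere b ℓ hq)

/-- Transported boundary heights are continuous on the transported boundary. [folklore] -/
theorem continuousOn (b : ℝ × ℝ) (hψ : ContinuousOn ψ (sphere b ℓ)) :
    ContinuousOn (fun y ↦ ψ (T.symm y)) (sphere (T b) ℓ) :=
  hψ.comp T.symm.continuous.continuousOn fun _ hq ↦ hT.symm_mem_sphere b ℓ hq

end IsPlaneMotion

/-- **The right-angle rotation `rot a` is a motion.** [folklore] -/
theorem isPlaneMotion_rot (a : ℝ × ℝ) : IsPlaneMotion (rot a) := by
  refine ⟨fun x y ↦ ?_, fun b q t ↦ ?_⟩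
  · rw [Prod.dist_eq, Prod.dist_eq, rot_apply, rot_apply, Real.dist_eq, Real.dist_eq, Real.dist_eq, Real.dist_eq]
    simp only
    rw [show a.1 - (x.2 - a.2) - (a.1 - (y.2 - a.2)) = -(x.2 - y.2) by ring, abs_neg,
      show a.2 + (x.1 - a.1) - (a.2 + (y.1 - a.1)) = x.1 - y.1 by ring, max_comm]
  · rw [rot_apply, rot_apply, rot_apply]
    ext <;> simp only [Prod.fst_add, Prod.smul_fst, Prod.fst_sub, smul_eq_mul, Prod.snd_add, Prod.smul_snd, Prod.snd_sub] <;> ring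

/-- Motions compose. [folklore] -/
theorem IsPlaneMotion.trans {T T' : (ℝ × ℝ) ≃ₜ (ℝ × ℝ)} (hT : IsPlaneMotion T) (hT' : IsPlaneMotion T') :
    IsPlaneMotion (T.trans T') := by
  refine ⟨fun x y ↦ ?_, fun b q t ↦ ?_⟩
  · show dist (T' (T x)) (T' (T y)) = dist x y; rw [hT'.dist_eq, hT.dist_eq]
  · show T' (T (b + t • (q - b))) = T' (T b) + t • (T' (T q) - T' (T b)); rw [hT.affine, hT'.affine]

/-- The identity is a motion. [folklore] -/
theorem isPlaneMotion_refl : IsPlaneMotion (Homeomorph.refl (ℝ × ℝ)) := ⟨fun _ _ ↦ rfl, fun _ _ _ ↦ rfl⟩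

/-! ## The edge chart in general position -/

/-- **Roof–floor data of two adjacent squares in general position**: roof on `Q = closedBall a ℓ`,
floor on `Q' = closedBall b ℓ`, compatibility `ψ = σ ∘ ψ'` on the common boundary part, and a
motion `T` bringing `Q'` to the right of `Q`. [folklore] -/
structure EdgeDataAt (a b : ℝ × ℝ) (ℓ m m' : ℝ) (ψ ψ' : ℝ × ℝ → ℝ) (σ : ℝ ≃o ℝ) (T : (ℝ × ℝ) ≃ₜ (ℝ × ℝ)) : Prop where
  hℓ : 0 < ℓ
  roof : ∀ q ∈ sphere a ℓ, ψ q < m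
  floor : ∀ q ∈ sphere b ℓ, m' < ψ' q
  cont : ContinuousOn ψ (sphere a ℓ)
  cont' : ContinuousOn ψ' (sphere b ℓ)
  compat : ∀ y ∈ sphere a ℓ ∩ sphere b ℓ, ψ y = σ (ψ' y)
  motion : IsPlaneMotion T
  map_right : T b = rightCenter (T a) ℓ

namespace EdgeDataAt

variable {T : (ℝ × ℝ) ≃ₜ (ℝ × ℝ)} (E : EdgeDataAt a b ℓ m m' ψ ψ' σ T)
include E

/-- The transported data satisfy the hypotheses of the standard edge chart at centre `T a`.
[folklore] -/
theorem edgeData : EdgeData (T a) ℓ m m' (fun y ↦ ψ (T.symm y)) (fun y ↦ ψ' (T.symm y)) σ := by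
  refine ⟨E.hℓ, E.motion.roof a E.roof, ?_, E.motion.continuousOn a E.cont, ?_, fun s hs ↦ ?_⟩
  · rw [← E.map_right]; exact E.motion.floor b E.floor
  · rw [← E.map_right]; exact E.motion.continuousOn b E.cont'
  · apply E.compat
    constructor
    · apply E.motion.symm_mem_sphere a ℓ
      -- the edge point lies on the sphere about `T a`
      rw [mem_sphere, Prod.dist_eq, edgePt, Real.dist_eq, Real.dist_eq]
      simp only
      rw [show (T a).1 + ℓ - (T a).1 = ℓ by ring, abs_of_pos E.hℓ]
      exact max_eq_left (abs_le.2 ⟨by linarith [hs.1], by linarith [hs.2]⟩)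
    · apply E.motion.symm_mem_sphere b ℓ
      rw [E.map_right, mem_sphere, Prod.dist_eq, edgePt, rightCenter, Real.dist_eq, Real.dist_eq]
      simp only
      rw [show (T a).1 + ℓ - ((T a).1 + 2 * ℓ) = -ℓ by ring, abs_neg, abs_of_pos E.hℓ]
      exact max_eq_left (abs_le.2 ⟨by linarith [hs.1], by linarith [hs.2]⟩)

/-- **The edge chart in general position**: the motion followed by the standard edge chart of the
transported data. [folklore] -/
def chart : OpenPartialHomeomorph (ℝ × ℝ) (ℝ × ℝ) := T.toOpenPartialHomeomorph.trans E.edgeData.edgeChart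

/-- The source of the general edge chart is the preimage of the diamond. [folklore] -/
theorem chart_source : E.chart.source = T ⁻¹' edgeDiamond (T a) ℓ := by
  rw [chart, OpenPartialHomeomorph.trans_source, Homeomorph.toOpenPartialHomeomorph_source, univ_inter]; rfl

/-- **The height coordinate of the general edge chart**: the cone height of `Q` on the `Q`-side,
the converted cone height of `Q'` on the `Q'`-side (sides read after the motion). [folklore] -/
theorem chart_snd (x : ℝ × ℝ) :
    (E.chart x).2 = if (T x).1 ≤ (T a).1 + ℓ then coneHt a ℓ m ψ x else σ (coneHt b ℓ m' ψ' x) := by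
  show (E.edgeData.edgeChart (T x)).2 = _
  rw [EdgeData.edgeChart_snd, edgeHt]
  by_cases hside : (T x).1 ≤ (T a).1 + ℓ
  · rw [if_pos hside, if_pos hside, E.motion.coneHt_eq]
  · rw [if_neg hside, if_neg hside, ← E.map_right, E.motion.coneHt_eq]

/-- A point of the common edge (image of an edge point) lies in the source. [folklore] -/
theorem symm_edgePt_mem_source {s : ℝ} (hs : s ∈ Ioo ((T a).2 - ℓ) ((T a).2 + ℓ)) : T.symm (edgePt (T a) ℓ s) ∈ E.chart.source := by
  rw [chart_source, mem_preimage, T.apply_symm_apply]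
  exact E.edgeData.edgePt_mem_edgeDiamond hs

end EdgeDataAt

/-! ## The four neighbours -/

/-- The `k`-fold rotation about `a` is a motion. [folklore] -/
theorem isPlaneMotion_rot_iterate (a : ℝ × ℝ) :
    ∀ k : ℕ, IsPlaneMotion (Nat.iterate (fun S : (ℝ × ℝ) ≃ₜ (ℝ × ℝ) ↦ S.trans (rot a)) k (Homeomorph.refl _))
  | 0 => isPlaneMotion_refl
  | k + 1 => by
    rw [Function.iterate_succ_apply']
    exact (isPlaneMotion_rot_iterate a k).trans (isPlaneMotion_rot a)

/-- **Each of the four neighbours of a square is brought to its right by a power of the rotation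
about its centre** (which fixes the centre). [folklore] -/
theorem exists_motion_of_adjacent (a : ℝ × ℝ) (ℓ : ℝ) (b : ℝ × ℝ)
    (hb : b = (a.1 + 2 * ℓ, a.2) ∨ b = (a.1, a.2 + 2 * ℓ) ∨ b = (a.1 - 2 * ℓ, a.2) ∨ b = (a.1, a.2 - 2 * ℓ)) :
    ∃ T : (ℝ × ℝ) ≃ₜ (ℝ × ℝ), IsPlaneMotion T ∧ T a = a ∧ T b = rightCenter (T a) ℓ := by
  set R := fun k : ℕ ↦ Nat.iterate (fun S : (ℝ × ℝ) ≃ₜ (ℝ × ℝ) ↦ S.trans (rot a)) k (Homeomorph.refl _) with hR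
  have hfix : ∀ k, R k a = a := by
    intro k
    induction k with
    | zero => rfl
    | succ k ih =>
      show (Nat.iterate (fun S : (ℝ × ℝ) ≃ₜ (ℝ × ℝ) ↦ S.trans (rot a)) (k + 1) (Homeomorph.refl _)) a = a
      rw [Function.iterate_succ_apply']
      show rot a (R k a) = a
      rw [ih, rot_apply]; ext <;> simp
  have e1 : ∀ p, R 1 p = rot a p := fun p ↦ rfl
  have e2 : ∀ p, R 2 p = rot a (rot a p) := fun p ↦ rfl
  have e3 : ∀ p, R 3 p = rot a (rot a (rot a p)) := fun p ↦ rfl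
  rcases hb with rfl | rfl | rfl | rfl
  · exact ⟨R 0, isPlaneMotion_rot_iterate a 0, rfl, rfl⟩
  · refine ⟨R 3, isPlaneMotion_rot_iterate a 3, hfix 3, ?_⟩
    rw [hfix 3, e3, rot_apply, rot_apply, rot_apply, rightCenter]
    ext <;> simp only <;> ring
  · refine ⟨R 2, isPlaneMotion_rot_iterate a 2, hfix 2, ?_⟩
    rw [hfix 2, e2, rot_apply, rot_apply, rightCenter]
    ext <;> simp only <;> ring
  · refine ⟨R 1, isPlaneMotion_rot_iterate a 1, hfix 1, ?_⟩
    rw [hfix 1, e1, rot_apply, rightCenter]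
    ext <;> simp only <;> ring

end ConeSquare

end Literature.Topology.FourManifolds
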